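import Summits.BirchSwinnertonDyer.BirchSwinnertonDyer.Theorems.KatoDescentPotSupersingularProPrimeToPVanishing
import Literature.NumberTheory.GaloisRepresentations.LocalFieldCdTwo
import Literature.NumberTheory.GaloisRepresentations.InertiaPadicCharacterProofs
import Literature.NumberTheory.EllipticCurves.CyclotomicZpExtensionUnramifiedAwayPProofs
import Literature.NumberTheory.EllipticCurves.ZpExtensionUnramifiedProofs
import Literature.NumberTheory.EllipticCurves.Greenberg1999.LocalH1DivisibleCyclotomicProofs
import Literature.NumberTheory.EllipticCurves.Kobayashi2003.FineSelmerLeSignedSelmerProofs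
import Mathlib.Topology.Algebra.ClopenNhdofOne
import Mathlib.Data.ZMod.QuotientGroup
import HarnessLib

/-!
# Unramified at `v ∤ p` over `K` ⟹ trivial over the completion of the cyclotomic tower: for `κ`
# cyclotomic, a class of `H¹(·, M)` (`M` discrete `p`-primary) killed on `I_v` is killed on
# `Gal(K̄/K_∞) ⊓ D_v` — the `ℓ ≠ p` step of the EXACT fine control count for crux M (19196)

Seat `bsd-potss-rkm` g27 (prover, cell `bsd-potss`), `--supports stmt-BirchSwinnertonDyer-19196 --as helper`;
closes nothing.  HONEST FRAMING: BSD is not proved by any of this; nothing is booked; theorems only (no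
definition, no named fact, no `sorry`).

## What and why

Sequel of `KatoDescentPotSupersingularProPrimeToPVanishing.lean` (the abstract KEY lemma: a class killed
on `I` is killed on a compact `N ≥ I` whose open subgroups above `I` have `p′`-index).  Here the
`p′`-index hypothesis is DISCHARGED for `N = Gal(K̄/K_∞) ⊓ D_v`, `I = I_v` at a finite place `v ∤ p` of a
number field `K` and the cyclotomic `ℤ_p`-extension `κ`:

* §1 (local, any non-archimedean local field `F`, any continuous `ψ : Γ_F → ℤ_p` killing `I_F`)
  `toAdd_apply_frob_dvd` — `ψ(φ) ∣ ψ(σ)` for a Frobenius `φ` (Frobenius generates `Γ_F` modulo every open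
  normal subgroup above `I_F`, tree `exists_pow_eq_mk`); **`index_coprime_of_isOpen_of_absInertia_le`** —
  for `ψ` non-trivial, every subgroup of `N = ker ψ` open in `N` and containing `I_F` has index prime to
  `p` (`N/I_F` is the prime-to-`p` part of `Gal(F^nr/F) ≅ Ẑ`: shrink to `N ∩ U`, `U ≥ I_F` open normal
  with `U ⊆ ψ⁻¹(p^{v(ψφ)+e}ℤ_p)`, `p^e ∥ [Γ_F:U]`; `σ ≡ φ^b (mod U)` and `ψσ = 0` force `p^e ∣ b`, so `N`
  maps into `⟨φ̄^{p^e}⟩ ≤ Γ_F/U`, of order `[Γ_F:U]/p^e`).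
* §2 (global) **`resOfLe_kerSubgroup_inf_decomp_eq_zero_of_resOfLe_inertia_eq_zero`** — for `K` a number
  field, `κ` CYCLOTOMIC, `v ∤ p`, `M` a discrete `p`-primary `Γ_K`-module with continuous action and
  `H ≥ Gal(K̄/K_∞) ⊓ D_v`: `res_{I_v} c = 0 ⟹ res_{Gal(K̄/K_∞) ⊓ D_v} c = 0` for `c ∈ H¹(H, M)` — with
  `ψ = κ ∘ res_v`, which kills `I_{K_v}` (residue characteristic `≠ p`, tree
  `apply_eq_one_of_mem_absInertia`) and is non-trivial (no finite place splits completely in `K_∞^{cyc}`,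
  tree `exists_apply_resGal_ne_one_of_isCyclotomic`); `I_v ≤ ker κ` is the tree's
  `greenbergInertia_le_kerSubgroup_of_isCyclotomic`.  The converse («trivial on `Gal(K̄/K_∞) ⊓ D_v` ⟹
  unramified») is restriction along `I_v ≤ Gal(K̄/K_∞) ⊓ D_v`.

Consumer: the exact fine control count `#Sel₀(ℚ_∞, W[p^∞])^Γ = #Sel_str(ℚ, W[p^∞])` on the rows of crux M
with `W(ℚ_p)[p] = 0` (memo FINDING-19196-rkm-g26 §3b; clause (c2′) of the held package 27962 there).

References: R. Greenberg, V. Vatsal, Invent. Math. 142 (2000) §2 Prop. (2.4) [GreenbergVatsal2000];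
R. Greenberg, LNM 1716 (1999) §3 Lemma 3.3 and Prop. 3.8 [GreenbergLNM1716]; J.-P. Serre, *Local Fields*
(1979) IV §4, XIII §1 [SerreLocalFields1979]; J. Tate, in *Corvallis* (1979) (1.4.1) [Corvallis1979];
L. Washington, *Introduction to Cyclotomic Fields* (1997) Prop. 13.2, §13.1 [Washington1997].
-/

-- the summit and its single problem are both named `BirchSwinnertonDyer` (registry layout D-0017)
set_option linter.dupNamespace false
set_option autoImplicit false

noncomputable section

open scoped Classical Pointwise
open Function
open Literature.NumberTheory.EllipticCurves Literature.NumberTheory.GaloisRepresentations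
open Summit.BirchSwinnertonDyer.BirchSwinnertonDyer.Theorems.ProPrimeToPVanishing

universe u

namespace Summit.BirchSwinnertonDyer.BirchSwinnertonDyer.Theorems.UnramifiedTrivialOverTower

/-! ## §1 The local structure: for a `ℤ_p`-valued character `ψ` of `Γ_F` killing inertia and
non-trivial, every open subgroup of `ker ψ` above `I_F` has index prime to `p` -/

section Local

open Field IsNonarchimedeanLocalField

variable {F : Type u} [Field F] [ValuativeRel F] [TopologicalSpace F] [IsNonarchimedeanLocalField F]
  {p : ℕ} [hp : Fact p.Prime]

omit [ValuativeRel F] [TopologicalSpace F] [IsNonarchimedeanLocalField F] in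
/-- Membership in `ψ⁻¹(p^k ℤ_p)`: `p^k ∣ ψ σ`. [folklore] -/
theorem mem_comap_span_pow_iff (ψ : absoluteGaloisGroup F →ₜ* Multiplicative ℤ_[p]) (k : ℕ)
    (σ : absoluteGaloisGroup F) :
    σ ∈ (AddSubgroup.toSubgroup (Ideal.span {(p : ℤ_[p]) ^ k}).toAddSubgroup).comap ψ.toMonoidHom ↔
      (p : ℤ_[p]) ^ k ∣ (ψ σ).toAdd := by
  rw [Subgroup.mem_comap, Multiplicative.mem_toSubgroup, Submodule.mem_toAddSubgroup,
    Ideal.mem_span_singleton]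
  rfl

omit [ValuativeRel F] [TopologicalSpace F] [IsNonarchimedeanLocalField F] in
/-- `ψ⁻¹(p^k ℤ_p)` is open (`p^k ℤ_p` is a closed ball of positive radius in an ultrametric space).
[cite: Washington1997, §13.1] -/
theorem isOpen_comap_span_pow (ψ : absoluteGaloisGroup F →ₜ* Multiplicative ℤ_[p]) (k : ℕ) :
    IsOpen ((AddSubgroup.toSubgroup (Ideal.span {(p : ℤ_[p]) ^ k}).toAddSubgroup).comap ψ.toMonoidHom :
      Set (absoluteGaloisGroup F)) := by
  have hball : ((Ideal.span {(p : ℤ_[p]) ^ k} : Ideal ℤ_[p]) : Set ℤ_[p]) =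
      Metric.closedBall (0 : ℤ_[p]) ((p : ℝ) ^ (-k : ℤ)) := by
    ext x
    rw [SetLike.mem_coe, Metric.mem_closedBall, dist_zero_right,
      PadicInt.norm_le_pow_iff_mem_span_pow]
  have hopen : IsOpen ((Ideal.span {(p : ℤ_[p]) ^ k} : Ideal ℤ_[p]) : Set ℤ_[p]) := by
    rw [hball]
    refine IsUltrametricDist.isOpen_closedBall _ (zpow_ne_zero _ ?_)
    exact_mod_cast hp.out.ne_zero
  exact hopen.preimage (map_continuous ψ)

/-- **Frobenius divides the character**: if `ψ : Γ_F → ℤ_p` kills the inertia group then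
`ψ(φ) ∣ ψ(σ)` in `ℤ_p` for a Frobenius `φ` and every `σ` (write `σ ≡ φ^i` modulo the open normal
subgroup `ψ⁻¹(p^k ℤ_p) ≥ I_F`, `exists_pow_eq_mk`). [cite: SerreLocalFields1979, IV §4 and XIII §1]
[cite: Corvallis1979, (1.4.1)] -/
theorem toAdd_apply_frob_dvd (ψ : absoluteGaloisGroup F →ₜ* Multiplicative ℤ_[p])
    (hI : ∀ σ ∈ absInertia F, ψ σ = 1) {φ : absoluteGaloisGroup F} (hφ : IsFrobPow φ 1)
    (σ : absoluteGaloisGroup F) : (ψ φ).toAdd ∣ (ψ σ).toAdd := by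
  have hIU : ∀ k, absInertia F ≤
      (AddSubgroup.toSubgroup (Ideal.span {(p : ℤ_[p]) ^ k}).toAddSubgroup).comap ψ.toMonoidHom :=
    fun k τ hτ ↦ by rw [mem_comap_span_pow_iff, hI τ hτ, toAdd_one]; exact dvd_zero _
  -- `ψ σ ∈ ℤ ψ(φ) + p^k ℤ_p` for every `k`
  have hk : ∀ k : ℕ, ∃ i : ℕ, (p : ℤ_[p]) ^ k ∣ (ψ σ).toAdd - i * (ψ φ).toAdd := fun k ↦ by
    obtain ⟨i, hi⟩ := exists_pow_eq_mk (F := F) (isOpen_comap_span_pow ψ k) (hIU k) hφ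
      (QuotientGroup.mk σ)
    refine ⟨i, ?_⟩
    rw [← QuotientGroup.mk_pow, QuotientGroup.eq, mem_comap_span_pow_iff, map_mul, map_inv, map_pow,
      toAdd_mul, toAdd_inv, toAdd_pow] at hi
    have e : (ψ σ).toAdd - i * (ψ φ).toAdd = -(-(ψ σ).toAdd + i • (ψ φ).toAdd) := by
      rw [nsmul_eq_mul]; ring
    rw [e]
    exact (dvd_neg.mpr hi)
  set a : ℤ_[p] := (ψ φ).toAdd with ha_def
  set x : ℤ_[p] := (ψ σ).toAdd with hx_def
  by_cases ha : a = 0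
  · -- then `ψ σ ∈ ⋂ₖ p^k ℤ_p = 0`
    have h0 : x = 0 := by
      by_contra hne
      obtain ⟨i, hi⟩ := hk (x.valuation + 1)
      rw [ha, mul_zero, sub_zero, ← Ideal.mem_span_singleton,
        PadicInt.mem_span_pow_iff_le_valuation x hne] at hi
      omega
    rw [h0]; exact dvd_zero _
  · set v : ℕ := a.valuation with hv
    obtain ⟨i, hi⟩ := hk v
    have hu : a = (PadicInt.unitCoeff ha : ℤ_[p]) * (p : ℤ_[p]) ^ v := PadicInt.unitCoeff_spec ha
    have hpa : (p : ℤ_[p]) ^ v ∣ a := ⟨PadicInt.unitCoeff ha, by rw [mul_comm]; exact hu⟩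
    have h1 : (p : ℤ_[p]) ^ v ∣ x := by
      have h2 : (p : ℤ_[p]) ^ v ∣ (i : ℤ_[p]) * a := hpa.mul_left _
      have := dvd_add hi h2
      rwa [sub_add_cancel] at this
    have h3 : a ∣ (p : ℤ_[p]) ^ v := by
      rw [hu]
      exact (Units.isUnit _).mul_left_dvd.mpr (dvd_refl _)
    exact h3.trans h1

/-- **The `p′`-index lemma.** Let `ψ : Γ_F → ℤ_p` be a non-trivial continuous character of the
absolute Galois group of a non-archimedean local field which kills the inertia group `I_F` (e.g. any
`ℤ_p`-valued character when the residue characteristic is `≠ p`), and `N = ker ψ` (so `N ⊇ I_F` and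
`N/I_F ≅ ∏_{ℓ ≠ p} ℤ_ℓ` is the prime-to-`p` part of `Gal(F^nr/F) ≅ Ẑ`).  Then every subgroup of `N`
that is open in `N` and contains `I_F` has index prime to `p`.  Proof: shrink to `N ∩ U` for an open
normal `U ≥ I_F` of `Γ_F` with `U ⊆ ψ⁻¹(p^{v(ψφ)+e} ℤ_p)`, `p^e ∥ [Γ_F : U]`; Frobenius generates
`Γ_F/U` (`exists_pow_eq_mk`) and `σ ≡ φ^b (mod U)`, `ψ σ = 0` force `p^e ∣ b`, so the image of `N` in
`Γ_F/U` lies in `⟨φ̄^{p^e}⟩`, of order `[Γ_F:U]/p^e`. [cite: SerreLocalFields1979, IV §4 and XIII §1]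
[cite: GreenbergVatsal2000, §2 Prop. (2.4) (the decomposition group in `ℚ_∞` at `ℓ ≠ p`)] -/
theorem index_coprime_of_isOpen_of_absInertia_le (ψ : absoluteGaloisGroup F →ₜ* Multiplicative ℤ_[p])
    (hI : ∀ σ ∈ absInertia F, ψ σ = 1) (hψ : ∃ σ, ψ σ ≠ 1)
    (V : Subgroup ψ.toMonoidHom.ker) (hV : IsOpen (V : Set ψ.toMonoidHom.ker))
    (hIV : ∀ x : ψ.toMonoidHom.ker, (x : absoluteGaloisGroup F) ∈ absInertia F → x ∈ V) :
    V.index.Coprime p := by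
  haveI := absoluteGaloisGroup_compactSpace F
  have hmemN : ∀ {x : absoluteGaloisGroup F}, x ∈ ψ.toMonoidHom.ker ↔ ψ x = 1 :=
    fun {x} ↦ MonoidHom.mem_ker
  obtain ⟨φ, hφ⟩ := exists_isFrobPow_holds (F := F) 1
  set a : ℤ_[p] := (ψ φ).toAdd with ha_def
  have ha : a ≠ 0 := by
    intro h
    obtain ⟨σ, hσ⟩ := hψ
    have hd := toAdd_apply_frob_dvd ψ hI hφ σ
    rw [← ha_def, h, zero_dvd_iff] at hd
    exact hσ (Multiplicative.toAdd.injective (by rw [hd, toAdd_one]))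
  -- Step 1: an open normal `W ≤ Γ_F` with `W ∩ ψ.toMonoidHom.ker ⊆ V`
  obtain ⟨O, hO, hOV⟩ := isOpen_induced_iff.mp hV
  have h1O : (1 : absoluteGaloisGroup F) ∈ O := by
    have h1 : (1 : ψ.toMonoidHom.ker) ∈ ((↑) : ψ.toMonoidHom.ker → absoluteGaloisGroup F) ⁻¹' O := by rw [hOV]; exact V.one_mem
    exact h1
  obtain ⟨W, hWO⟩ := ProfiniteGrp.exist_openNormalSubgroup_sub_open_nhds_of_one hO h1O
  -- Step 2: `U = W · I_F`, open normal, `⊇ I_F`, with `U ∩ ψ.toMonoidHom.ker ⊆ V`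
  let U : Subgroup (absoluteGaloisGroup F) := (W : Subgroup (absoluteGaloisGroup F)) ⊔ absInertia F
  have hUopen : IsOpen (U : Set (absoluteGaloisGroup F)) :=
    Subgroup.isOpen_mono (le_sup_left : (W : Subgroup (absoluteGaloisGroup F)) ≤ U) W.isOpen
  have hIU : absInertia F ≤ U := le_sup_right
  have hUN : ∀ x : ψ.toMonoidHom.ker, (x : absoluteGaloisGroup F) ∈ U → x ∈ V := by
    intro x hx
    have hx' : (x : absoluteGaloisGroup F) ∈
        ((W : Subgroup (absoluteGaloisGroup F)) : Set (absoluteGaloisGroup F)) *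
          (absInertia F : Set (absoluteGaloisGroup F)) := by
      rw [← Subgroup.mul_normal]; exact hx
    obtain ⟨w, hw, i, hi, hwi⟩ := Set.mem_mul.mp hx'
    have hiN : i ∈ ψ.toMonoidHom.ker := hmemN.2 (hI i hi)
    have hwN : w ∈ ψ.toMonoidHom.ker := by
      have : w = (x : absoluteGaloisGroup F) * i⁻¹ := by rw [← hwi, mul_inv_cancel_right]
      rw [this]; exact ψ.toMonoidHom.ker.mul_mem x.2 (ψ.toMonoidHom.ker.inv_mem hiN)
    have hwV : (⟨w, hwN⟩ : ψ.toMonoidHom.ker) ∈ V := by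
      have : (⟨w, hwN⟩ : ψ.toMonoidHom.ker) ∈ ((↑) : ψ.toMonoidHom.ker → absoluteGaloisGroup F) ⁻¹' O := hWO hw
      rwa [hOV] at this
    have hiV : (⟨i, hiN⟩ : ψ.toMonoidHom.ker) ∈ V := hIV _ hi
    have hxe : x = ⟨w, hwN⟩ * ⟨i, hiN⟩ := Subtype.ext hwi.symm
    rw [hxe]; exact V.mul_mem hwV hiV
  -- Step 3: the deeper open normal subgroup `U'' = U ⊓ ψ⁻¹(p^{v+e} ℤ_p)`
  haveI : Finite (absoluteGaloisGroup F ⧸ U) := Subgroup.quotient_finite_of_isOpen U hUopen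
  set n : ℕ := U.index with hn_def
  have hn0 : n ≠ 0 := Subgroup.index_ne_zero_of_finite
  set e : ℕ := n.factorization p with he_def
  set v : ℕ := a.valuation with hv_def
  let L : Subgroup (absoluteGaloisGroup F) :=
    (AddSubgroup.toSubgroup (Ideal.span {(p : ℤ_[p]) ^ (v + e)}).toAddSubgroup).comap ψ.toMonoidHom
  let U'' : Subgroup (absoluteGaloisGroup F) := U ⊓ L
  have hU''open : IsOpen (U'' : Set (absoluteGaloisGroup F)) := hUopen.inter (isOpen_comap_span_pow ψ _)
  have hIL : absInertia F ≤ L := fun τ hτ ↦ by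
    change τ ∈ (AddSubgroup.toSubgroup _).comap _
    rw [mem_comap_span_pow_iff, hI τ hτ, toAdd_one]; exact dvd_zero _
  have hIU'' : absInertia F ≤ U'' := le_inf hIU hIL
  have hu : a = (PadicInt.unitCoeff ha : ℤ_[p]) * (p : ℤ_[p]) ^ v := PadicInt.unitCoeff_spec ha
  -- Step 4: the image of `ψ.toMonoidHom.ker` in `Γ_F ⧸ U` lies in `⟨φ̄ ^ p^e⟩`
  set g : absoluteGaloisGroup F ⧸ U := QuotientGroup.mk φ with hg_def
  have hmem : ∀ x ∈ ψ.toMonoidHom.ker, (QuotientGroup.mk x : absoluteGaloisGroup F ⧸ U) ∈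
      Subgroup.zpowers (g ^ p ^ e) := by
    intro x hxN
    obtain ⟨b, hb⟩ := exists_pow_eq_mk (F := F) hU''open hIU'' hφ (QuotientGroup.mk x)
    rw [← QuotientGroup.mk_pow, QuotientGroup.eq] at hb
    have hb1 : x⁻¹ * φ ^ b ∈ U := (Subgroup.mem_inf.mp hb).1
    have hb2 : x⁻¹ * φ ^ b ∈ L := (Subgroup.mem_inf.mp hb).2
    change x⁻¹ * φ ^ b ∈ (AddSubgroup.toSubgroup _).comap _ at hb2
    rw [mem_comap_span_pow_iff, map_mul, map_inv, map_pow, toAdd_mul, toAdd_inv, toAdd_pow,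
      hmemN.1 hxN, toAdd_one, neg_zero, zero_add, ← ha_def, nsmul_eq_mul] at hb2
    -- `p^{v+e} ∣ b·u·p^v` ⟹ `p^e ∣ b`
    have hpe : p ^ e ∣ b := by
      rw [hu, pow_add, mul_comm ((p : ℤ_[p]) ^ v), ← mul_assoc] at hb2
      have h1 : (p : ℤ_[p]) ^ e ∣ (b : ℤ_[p]) * (PadicInt.unitCoeff ha : ℤ_[p]) :=
        (mul_dvd_mul_iff_right (pow_ne_zero _ (NeZero.ne _))).mp hb2
      have h2 : (p : ℤ_[p]) ^ e ∣ ((b : ℤ) : ℤ_[p]) := by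
        rw [Int.cast_natCast]; exact (Units.isUnit (PadicInt.unitCoeff ha)).dvd_mul_right.mp h1
      have h3 : ((p ^ e : ℕ) : ℤ) ∣ (b : ℤ) := by
        have := (PadicInt.pow_p_dvd_int_iff e b).mp h2; exact_mod_cast this
      exact Int.natCast_dvd_natCast.mp h3
    obtain ⟨c, hc⟩ := hpe
    have hxg : (QuotientGroup.mk x : absoluteGaloisGroup F ⧸ U) = g ^ b := by
      rw [hg_def, ← QuotientGroup.mk_pow, QuotientGroup.eq]; exact hb1
    rw [hxg, hc, pow_mul]
    exact Subgroup.npow_mem_zpowers _ _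
  -- Step 5: orders in the cyclic group `Γ_F ⧸ U = ⟨φ̄⟩`
  have hgen : ∀ q : absoluteGaloisGroup F ⧸ U, q ∈ Subgroup.zpowers g := fun q ↦ by
    obtain ⟨i, hi⟩ := exists_pow_eq_mk (F := F) hUopen hIU hφ q
    rw [hi]; exact Subgroup.npow_mem_zpowers _ _
  have horder : orderOf g = n := by
    rw [orderOf_eq_card_of_forall_mem_zpowers hgen, hn_def, Subgroup.index]
  have hcardC : Nat.card (Subgroup.zpowers (g ^ p ^ e)) = n / p ^ e := by
    rw [Nat.card_zpowers, orderOf_pow' _ (pow_ne_zero _ hp.out.ne_zero), horder,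
      Nat.gcd_eq_right (Nat.ordProj_dvd n p)]
  have hcop : (n / p ^ e).Coprime p := (Nat.coprime_ordCompl hp.out hn0).symm
  -- Step 6: `[ψ.toMonoidHom.ker : V] ∣ [ψ.toMonoidHom.ker : ψ.toMonoidHom.ker ∩ U] = #(image of ψ.toMonoidHom.ker) ∣ n / p^e`
  let T : Subgroup ψ.toMonoidHom.ker := U.subgroupOf ψ.toMonoidHom.ker
  have hTV : T ≤ V := fun x hx ↦ hUN x (Subgroup.mem_subgroupOf.mp hx)
  let θ : ψ.toMonoidHom.ker →* absoluteGaloisGroup F ⧸ U := (QuotientGroup.mk' U).comp ψ.toMonoidHom.ker.subtype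
  have hker : θ.ker = T := by
    change ((QuotientGroup.mk' U).comp ψ.toMonoidHom.ker.subtype).ker = U.comap ψ.toMonoidHom.ker.subtype
    rw [← MonoidHom.comap_ker, QuotientGroup.ker_mk']
  have hrange : θ.range ≤ Subgroup.zpowers (g ^ p ^ e) := by
    rintro _ ⟨x, rfl⟩; exact hmem x x.2
  have hT : T.index = Nat.card θ.range := by rw [← hker]; exact Subgroup.index_ker θ
  have hdvd : V.index ∣ n / p ^ e := by
    calc V.index ∣ T.index := Subgroup.index_dvd_of_le hTV
      _ = Nat.card θ.range := hT
      _ ∣ Nat.card (Subgroup.zpowers (g ^ p ^ e)) := Subgroup.card_dvd_of_le hrange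
      _ = n / p ^ e := hcardC
  exact hcop.coprime_dvd_left hdvd

end Local


/-! ## §2 Over a number field: restriction to `Gal(K̄/K_∞) ⊓ D_v` (`v ∤ p`, `κ` cyclotomic) kills
every class that is unramified at `v` -/

section Global

open NumberField IsDedekindDomain Field
open Literature.NumberTheory.EllipticCurves.GreenbergSelmer Literature.NumberTheory.EllipticCurves.ZpExtension
  Literature.NumberTheory.EllipticCurves.Greenberg1999

variable {K : Type} [Field K] [NumberField K] {p : ℕ} [hp : Fact p.Prime] (κ : ZpExtension K p)
  {M : Type} [AddCommGroup M] [DistribMulAction (absoluteGaloisGroup K) M] [TopologicalSpace M]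
  [DiscreteTopology M]

/-- **Unramified at `v ∤ p` over `K` ⟹ locally trivial at the place of `K_∞` above `v`.**  For the
cyclotomic `ℤ_p`-extension `κ` of a number field `K`, a finite place `v ∤ p`, a discrete `p`-primary
`Γ_K`-module `M` with continuous action and any `H ≥ Gal(K̄/K_∞) ⊓ D_v`: a class of `H¹(H, M)` whose
restriction to the inertia group `I_v` vanishes restricts to zero on `Gal(K̄/K_∞) ⊓ D_v =
Gal(K̄_v/K_{∞,w})`.  (`K_{∞,w} ⊇ K_v^{nr,(p)}`: the group `Gal(K̄_v/K_{∞,w})/I_v ≅ ∏_{ℓ≠p} ℤ_ℓ` has no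
`p`-primary `H¹`; §1 with §2 for `ψ = κ ∘ res_v`, which kills `I_{K_v}` because the residue
characteristic is `≠ p` and is non-trivial because no finite place splits completely in `K_∞^{cyc}`.)
[cite: GreenbergVatsal2000, §2 Prop. (2.4)] [cite: GreenbergLNM1716, §3 (proof of Lemma 3.3, p. 87)]
[cite: Washington1997, Prop. 13.2] -/
theorem resOfLe_kerSubgroup_inf_decomp_eq_zero_of_resOfLe_inertia_eq_zero (hκ : κ.IsCyclotomic)
    {v : HeightOneSpectrum (𝓞 K)} (hv : ((p : ℕ) : 𝓞 K) ∉ v.asIdeal)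
    (hcont : ∀ m : M, Continuous fun g : absoluteGaloisGroup K ↦ g • m)
    (hprim : ∀ m : M, ∃ k : ℕ, p ^ k • m = 0)
    {H : Subgroup (absoluteGaloisGroup K)} (hH : κ.kerSubgroup ⊓ decomp v ≤ H)
    (hI : GreenbergSelmer.inertia v ≤ H) (c : subgroupH1 H M) (hc : resOfLe M hI c = 0) :
    resOfLe M hH c = 0 := by
  set F := v.adicCompletion K with hF
  set r : absoluteGaloisGroup F →ₜ* absoluteGaloisGroup K := absGaloisRestrict K F with hr
  have hIN : GreenbergSelmer.inertia v ≤ κ.kerSubgroup ⊓ decomp v :=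
    le_inf (greenbergInertia_le_kerSubgroup_of_isCyclotomic κ hκ hv) (inertia_le_decomp v)
  have hNc : IsCompact ((κ.kerSubgroup ⊓ decomp v : Subgroup (absoluteGaloisGroup K)) :
      Set (absoluteGaloisGroup K)) := by
    rw [Subgroup.coe_inf]
    exact (Kobayashi2003.isCompact_decomp v).inter_left κ.isClosed_kerSubgroup
  refine resOfLe_eq_zero_of_resOfLe_eq_zero_of_coprime_index hIN hH hcont hprim hNc ?_ c
    (by rw [show (hIN.trans hH) = hI from rfl]; exact hc)
  -- the `p′`-index property, transported from `Γ_{K_v}` along `res_v`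
  intro V hV hIV
  let ψ : absoluteGaloisGroup F →ₜ* Multiplicative ℤ_[p] := κ.toContinuousMonoidHom.comp r
  have hψI : ∀ σ ∈ absInertia F, ψ σ = 1 := fun σ hσ ↦
    apply_eq_one_of_mem_absInertia (v.ringChar_residueField_adicCompletion_ne hv) ψ hσ
  have hψ : ∃ σ, ψ σ ≠ 1 := exists_apply_resGal_ne_one_of_isCyclotomic hκ v
  -- `ρ : ker ψ ↠ ker κ ⊓ D_v`
  have hρmem : ∀ x : ψ.toMonoidHom.ker, r x ∈ κ.kerSubgroup ⊓ decomp v := fun x ↦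
    Subgroup.mem_inf.mpr ⟨by rw [mem_kerSubgroup]; exact x.2, (mem_decomp_iff v _).mpr ⟨x, rfl⟩⟩
  let ρ : ψ.toMonoidHom.ker →* (κ.kerSubgroup ⊓ decomp v : Subgroup (absoluteGaloisGroup K)) :=
    { toFun := fun x ↦ ⟨r x, hρmem x⟩
      map_one' := Subtype.ext (by simp)
      map_mul' := fun x y ↦ Subtype.ext (by simp only [Subgroup.coe_mul, map_mul]) }
  have hρcont : Continuous ρ :=
    (r.continuous_toFun.comp continuous_subtype_val).subtype_mk _
  have hρsurj : Function.Surjective ρ := by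
    rintro ⟨n, hn⟩
    obtain ⟨hn1, hn2⟩ := Subgroup.mem_inf.mp hn
    obtain ⟨σ, hσ⟩ := (mem_decomp_iff v n).mp hn2
    have hσN : σ ∈ ψ.toMonoidHom.ker := by
      rw [MonoidHom.mem_ker]
      change κ (r σ) = 1
      rw [hσ]; exact mem_kerSubgroup.mp hn1
    exact ⟨⟨σ, hσN⟩, Subtype.ext hσ⟩
  have hW : (V.comap ρ).index.Coprime p := by
    refine index_coprime_of_isOpen_of_absInertia_le ψ hψI hψ (V.comap ρ) (hV.preimage hρcont) ?_
    intro x hx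
    rw [Subgroup.mem_comap]
    exact hIV _ (Subgroup.mem_map_of_mem r.toMonoidHom hx)
  rwa [Subgroup.index_comap_of_surjective _ hρsurj] at hW

end Global

end Summit.BirchSwinnertonDyer.BirchSwinnertonDyer.Theorems.UnramifiedTrivialOverTower

end
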